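import Summits.RiemannHypothesis.RiemannHypothesis.Theorems.WeilTwoPrimeDeflM78FDef
import Summits.RiemannHypothesis.RiemannHypothesis.Theorems.WeilTwoPrimeDeflM78FDataPO25
import Literature.NumberTheory.LFunctions.WeilBlockRowsR
import HarnessLib

/-!
# Deflated two-prime certificate M78F: the materialized odd block agrees with `P_r + Σ μ ĉ ĉᵀ`, rows 120–127

`WeilCert.checkPmRowG` for certificate M78F (odd block), by `decide +kernel`. Pure proof file; nothing is asserted.
-/

noncomputable section

set_option linter.dupNamespace false

namespace Summit.RiemannHypothesis.RiemannHypothesis.Theorems.EvenWinsBeyondArch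

open Literature.NumberTheory.LFunctions

set_option maxHeartbeats 0 in
/-- Row 120 of the materialized odd block is row 120 of `P_r + Σ μ ĉ ĉᵀ` (certificate M78F). [folklore] -/
theorem checkPmRowG1_120_weilCertDeflM78F : weilCertDeflM78FBase.checkPmRowG weilCertDeflM78FP weilCertDeflM78FPmO 1 120 = true := by
  decide +kernel

set_option maxHeartbeats 0 in
/-- Row 121 of the materialized odd block is row 121 of `P_r + Σ μ ĉ ĉᵀ` (certificate M78F). [folklore] -/
theorem checkPmRowG1_121_weilCertDeflM78F : weilCertDeflM78FBase.checkPmRowG weilCertDeflM78FP weilCertDeflM78FPmO 1 121 = true := by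
  decide +kernel

set_option maxHeartbeats 0 in
/-- Row 122 of the materialized odd block is row 122 of `P_r + Σ μ ĉ ĉᵀ` (certificate M78F). [folklore] -/
theorem checkPmRowG1_122_weilCertDeflM78F : weilCertDeflM78FBase.checkPmRowG weilCertDeflM78FP weilCertDeflM78FPmO 1 122 = true := by
  decide +kernel

set_option maxHeartbeats 0 in
/-- Row 123 of the materialized odd block is row 123 of `P_r + Σ μ ĉ ĉᵀ` (certificate M78F). [folklore] -/
theorem checkPmRowG1_123_weilCertDeflM78F : weilCertDeflM78FBase.checkPmRowG weilCertDeflM78FP weilCertDeflM78FPmO 1 123 = true := by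
  decide +kernel

set_option maxHeartbeats 0 in
/-- Row 124 of the materialized odd block is row 124 of `P_r + Σ μ ĉ ĉᵀ` (certificate M78F). [folklore] -/
theorem checkPmRowG1_124_weilCertDeflM78F : weilCertDeflM78FBase.checkPmRowG weilCertDeflM78FP weilCertDeflM78FPmO 1 124 = true := by
  decide +kernel

set_option maxHeartbeats 0 in
/-- Row 125 of the materialized odd block is row 125 of `P_r + Σ μ ĉ ĉᵀ` (certificate M78F). [folklore] -/
theorem checkPmRowG1_125_weilCertDeflM78F : weilCertDeflM78FBase.checkPmRowG weilCertDeflM78FP weilCertDeflM78FPmO 1 125 = true := by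
  decide +kernel

set_option maxHeartbeats 0 in
/-- Row 126 of the materialized odd block is row 126 of `P_r + Σ μ ĉ ĉᵀ` (certificate M78F). [folklore] -/
theorem checkPmRowG1_126_weilCertDeflM78F : weilCertDeflM78FBase.checkPmRowG weilCertDeflM78FP weilCertDeflM78FPmO 1 126 = true := by
  decide +kernel

set_option maxHeartbeats 0 in
/-- Row 127 of the materialized odd block is row 127 of `P_r + Σ μ ĉ ĉᵀ` (certificate M78F). [folklore] -/
theorem checkPmRowG1_127_weilCertDeflM78F : weilCertDeflM78FBase.checkPmRowG weilCertDeflM78FP weilCertDeflM78FPmO 1 127 = true := by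
  decide +kernel


end Summit.RiemannHypothesis.RiemannHypothesis.Theorems.EvenWinsBeyondArch
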